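import Mathlib.Combinatorics.SimpleGraph.Bipartite
import Literature.Computability.QuantumComplexity.GluedTrees

/-!
# The glued-trees graphs `G'_n(σ)` are bipartite, with the ENTRANCE and the EXIT on opposite sides

Helper for the support item `WbwSuccinctWalk` (stmt-QuantumAdvantage-2360) of route
`Summits/QuantumAdvantage/QuantumAdvantage/Theses/WhiteBoxWalk` (clause (Q) of `WbwThesis` for the
glued-trees witness: the Childs–Cleve–Deotto–Farhi–Gutmann–Spielman quantum walk run on a
CIRCUIT-presented graph). In the circuit-input model the neighbour circuit returns adjacency lists
and NO edge colouring, so the walk Hamiltonian has to be simulated by the colourless construction of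
ChildsEtAl2003, Appendix B ("Implementation of the quantum walk starting from a particular vertex of
a bipartite graph": a parity bit, `0` at the ENTRANCE and flipped at every oracle step, turns the
ordered adjacency lists into a consistent colouring `(incoming colour, outgoing colour)` of the
undirected edges) — which requires the graph to be BIPARTITE with a known side for the start vertex.
This file proves exactly that for the tree's graphs `GluedTrees.graph n σ` (every cycle datum `σ`,
every `n`): the explicit side function `parity v = (depth v + [v is in the EXIT tree]) mod 2`
separates the endpoints of every edge (tree edges change the depth by one on the same side; cycle
edges join two leaves, both of depth `n`, on different sides), `parity ENTRANCE = 0`,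
`parity EXIT = 1`; hence `(graph n σ).IsBipartiteWith {parity = 0} {parity = 1}` and
`(graph n σ).IsBipartite` (Mathlib). [cite: ChildsEtAl2003, App. B and §2 (arXiv:quant-ph/0209131)]
-/

namespace Summit.QuantumAdvantage.QuantumAdvantage.Theorems.WbwSuccinctWalk

open Literature.Computability.QuantumComplexity GluedTrees

variable {n : ℕ}

/-- The side of a vertex of `G'_n` in the bipartition: `(depth + [right tree]) mod 2`, as a Boolean
(`false` = the ENTRANCE's side). This is the "parity bit" of ChildsEtAl2003, App. B.
[cite: ChildsEtAl2003, App. B] -/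
def parity (v : Vertex n) : Bool :=
  decide (((v.2.1 : ℕ) + v.1.toNat) % 2 = 1)

/-- The ENTRANCE is on side `0` ("The ENTRANCE is defined to be on side 0 of the bipartition").
[cite: ChildsEtAl2003, App. B] -/
@[simp] theorem parity_entrance (n : ℕ) : parity (entrance n) = false := by
  simp [parity, entrance]

/-- The EXIT is on side `1`. [cite: ChildsEtAl2003, App. B] -/
@[simp] theorem parity_exit (n : ℕ) : parity (GluedTrees.exit n) = true := by
  simp [parity, GluedTrees.exit]

/-- Left leaves have parity `n mod 2`. [cite: ChildsEtAl2003, §2] -/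
theorem parity_leafL (n : ℕ) (i : Fin (2 ^ n)) : parity (leafL n i) = decide (n % 2 = 1) := by
  simp [parity, leafL]

/-- Right leaves have parity `(n + 1) mod 2`. [cite: ChildsEtAl2003, §2] -/
theorem parity_leafR (n : ℕ) (i : Fin (2 ^ n)) : parity (leafR n i) = decide ((n + 1) % 2 = 1) := by
  simp [parity, leafR]

/-- A tree edge (child → parent: same side, depth one more) joins vertices of opposite parity.
[cite: ChildsEtAl2003, §2] -/
theorem parity_ne_of_isChild {u v : Vertex n} (h : IsChild u v) : parity u ≠ parity v := by
  obtain ⟨hs, hd, -⟩ := h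
  simp only [parity, hs, hd, ne_eq, decide_eq_decide]
  omega

/-- A cycle edge (left leaf — right leaf) joins vertices of opposite parity.
[cite: ChildsEtAl2003, §2] -/
theorem parity_ne_of_isGlued (σ : CycleDatum n) {u v : Vertex n} (h : IsGlued σ u v) :
    parity u ≠ parity v := by
  obtain ⟨k, ⟨rfl, rfl⟩ | ⟨rfl, rfl⟩⟩ := h
  · rw [parity_leafL, parity_leafR]
    simp only [ne_eq, decide_eq_decide]
    omega
  · rw [parity_leafR, parity_leafL]
    simp only [ne_eq, decide_eq_decide]
    omega

/-- **Adjacent vertices of `G'_n(σ)` have opposite parity.** [cite: ChildsEtAl2003, App. B] -/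
theorem parity_ne_of_adj (σ : CycleDatum n) {u v : Vertex n} (h : (graph n σ).Adj u v) :
    parity u ≠ parity v := by
  rw [graph_adj] at h
  obtain ⟨-, (hc | hg) | (hc | hg)⟩ := h
  · exact parity_ne_of_isChild hc
  · exact parity_ne_of_isGlued σ hg
  · exact (parity_ne_of_isChild hc).symm
  · exact (parity_ne_of_isGlued σ hg).symm

/-- **`G'_n(σ)` is bipartite with the explicit sides `{parity = 0}` (containing the ENTRANCE) and
`{parity = 1}` (containing the EXIT).** [cite: ChildsEtAl2003, App. B] -/
theorem graph_isBipartiteWith (σ : CycleDatum n) :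
    (graph n σ).IsBipartiteWith {v | parity v = false} {v | parity v = true} where
  disjoint := Set.disjoint_left.2 fun v (hv : parity v = false) (hv' : parity v = true) => by
    rw [hv] at hv'
    exact Bool.false_ne_true hv'
  mem_of_adj u v h := by
    have hne := parity_ne_of_adj σ h
    simp only [Set.mem_setOf_eq]
    cases hu : parity u <;> cases hv : parity v <;> simp_all

/-- **`G'_n(σ)` is bipartite** (`SimpleGraph.IsBipartite` = `2`-colourable). [cite: ChildsEtAl2003, App. B] -/
theorem graph_isBipartite (σ : CycleDatum n) : (graph n σ).IsBipartite :=
  (graph_isBipartiteWith σ).isBipartite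

/-- The ENTRANCE lies on side `0` of the bipartition `graph_isBipartiteWith`. [cite: ChildsEtAl2003, App. B] -/
theorem entrance_mem_side₀ (n : ℕ) : entrance n ∈ {v : Vertex n | parity v = false} :=
  parity_entrance n

/-- The EXIT lies on side `1` of the bipartition `graph_isBipartiteWith`. [cite: ChildsEtAl2003, App. B] -/
theorem exit_mem_side₁ (n : ℕ) : GluedTrees.exit n ∈ {v : Vertex n | parity v = true} :=
  parity_exit n

/-- Along any walk the parity alternates: a walk of length `ℓ` from `u` to `v` has
`parity v = parity u xor [ℓ odd]`; in particular every closed walk has even length and every walk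
from the ENTRANCE to the EXIT has odd length. [cite: ChildsEtAl2003, App. B] -/
theorem parity_eq_of_walk (σ : CycleDatum n) {u v : Vertex n} (p : (graph n σ).Walk u v) :
    parity v = (parity u ^^ decide (p.length % 2 = 1)) := by
  induction p with
  | nil => simp
  | @cons a b c hab p ih =>
    rw [ih, SimpleGraph.Walk.length_cons]
    have hne := parity_ne_of_adj σ hab
    cases ha : parity a <;> cases hb : parity b <;> simp_all [Nat.succ_mod_two_eq_one_iff] <;>
      cases Nat.mod_two_eq_zero_or_one p.length <;> simp_all

end Summit.QuantumAdvantage.QuantumAdvantage.Theorems.WbwSuccinctWalk
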